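import Summits.HubbardSuperconductivity.HubbardSuperconductivity.Theorems.AnisotropyChordTransferFibre3KT1Assembly

/-!
# Route `AnisotropyChord` / H0 rotor rung: the finer (KT-1″) assembly `N1FromPieces` — eight corners of `−Q·B/P` (PartN41-B §7)

Theory-1 g22's PartN41-B §7 (cycle22/lean/PartN41B.lean) refines `KT1Assembly.trialGapN1_ge_of_brackets` by keeping the
product `(T⁺ − 3λ₂)·B = Q·B/P` (`Q := ⟨Π⁰,C0⟩ = Σ_c Π⁰C0 = (T⁺ − 3λ₂)‖Π⁰‖²`, `sum_piR_C0fn`) and `T⁺‖Π⁰‖² = 3λ₂‖Π⁰‖² + Q`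
exactly, so that only the brackets of `B, ‖Π⁰‖², A(x̂), Q, B_C` enter:
`N₁ ≥ −ε₁B⁺ + min_{8 corners}(−Q·B/P) − (ε₁/2)(3λ₂P⁺ + Q⁺ + 12Δf(x̂)²A⁺) + B_C⁻`.
* `mul_ge_min_ends` / `neg_mul_div_ge_corners`: a (tri)linear form on a box is bounded below by its corner values;
* ★ `n1_ge_pieces`: the displayed inequality for a ground profile with `0 < λ₂`, `0 ≤ Δ`, `L ≥ 3` (the typed target
  `N1FromPieces L Δ` of PartN41-B is this statement; its `_holds` one-liner follows the port of the statement file).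
Prover seat `hubbard-h0-rotor-p1` g26 (route lead; per-row assembly); helper for stmt-HubbardSuperconductivity-23918 (`--supports`, helper class).
WHAT THIS IS NOT: nothing here proves superconductivity in the Hubbard model; interval bookkeeping of ONE row of ONE conditional reduction.
Tree imports only; no new definitions; no sorry, no axioms.
-/

set_option linter.dupNamespace false
set_option autoImplicit false

noncomputable section

open scoped BigOperators

namespace Summit.HubbardSuperconductivity.HubbardSuperconductivity.Theorems.AnisotropyChord.Transfer.Fibre3

namespace KT1Assembly

variable (L : ℕ) [NeZero L]

/-- a linear function on an interval is at least the smaller endpoint value: `α·w ≥ min(α·w₁, α·w₂)` for `w ∈ [w₁, w₂]`. [folklore] -/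
theorem mul_ge_min_ends (α w w1 w2 : ℝ) (h1 : w1 ≤ w) (h2 : w ≤ w2) : min (α * w1) (α * w2) ≤ α * w := by
  rcases le_or_gt 0 α with hα | hα
  · exact (min_le_left _ _).trans (mul_le_mul_of_nonneg_left h1 hα)
  · exact (min_le_right _ _).trans (by nlinarith)

/-- ★ the eight-corner lower bound: for `Q ∈ [Q⁻,Q⁺]`, `B ∈ [B⁻,B⁺]`, `P ∈ [P⁻,P⁺]`, `P⁻ > 0`,
`−Q·B/P ≥ min over the corners of −Q^±·B^±/P^±`. [folklore] -/
theorem neg_mul_div_ge_corners {Q B P Qlo Qhi Blo Bhi Plo Phi : ℝ}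
    (hQ1 : Qlo ≤ Q) (hQ2 : Q ≤ Qhi) (hB1 : Blo ≤ B) (hB2 : B ≤ Bhi) (hPlo : 0 < Plo) (hP1 : Plo ≤ P) (hP2 : P ≤ Phi) :
    min (min (min (-(Qlo * Blo / Plo)) (-(Qlo * Blo / Phi))) (min (-(Qlo * Bhi / Plo)) (-(Qlo * Bhi / Phi))))
        (min (min (-(Qhi * Blo / Plo)) (-(Qhi * Blo / Phi))) (min (-(Qhi * Bhi / Plo)) (-(Qhi * Bhi / Phi))))
      ≤ -(Q * B / P) := by
  have hP : 0 < P := lt_of_lt_of_le hPlo hP1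
  have hPhi : 0 < Phi := lt_of_lt_of_le hP hP2
  -- step 1: in `w = 1/P ∈ [1/P⁺, 1/P⁻]`, for fixed `Q, B`
  have hw1 : 1 / Phi ≤ 1 / P := one_div_le_one_div_of_le hP hP2
  have hw2 : 1 / P ≤ 1 / Plo := one_div_le_one_div_of_le hPlo hP1
  have s1 : ∀ q b : ℝ, min (-(q * b / Plo)) (-(q * b / Phi)) ≤ -(q * b / P) := by
    intro q b
    have h := mul_ge_min_ends (-(q * b)) (1 / P) (1 / Phi) (1 / Plo) hw1 hw2
    rw [min_comm] at h
    have e1 : -(q * b) * (1 / Plo) = -(q * b / Plo) := by ring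
    have e2 : -(q * b) * (1 / Phi) = -(q * b / Phi) := by ring
    have e3 : -(q * b) * (1 / P) = -(q * b / P) := by ring
    rw [e1, e2, e3] at h
    exact h
  -- step 2: in `B`, for fixed `Q`
  have s2 : ∀ q : ℝ, min (min (-(q * Blo / Plo)) (-(q * Blo / Phi))) (min (-(q * Bhi / Plo)) (-(q * Bhi / Phi)))
      ≤ -(q * B / P) := by
    intro q
    have hb := mul_ge_min_ends (-(q / P)) B Blo Bhi hB1 hB2
    have e1 : -(q / P) * Blo = -(q * Blo / P) := by ring
    have e2 : -(q / P) * Bhi = -(q * Bhi / P) := by ring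
    have e3 : -(q / P) * B = -(q * B / P) := by ring
    rw [e1, e2, e3] at hb
    refine le_trans ?_ hb
    exact min_le_min (s1 q Blo) (s1 q Bhi)
  -- step 3: in `Q`
  have hq := mul_ge_min_ends (-(B / P)) Q Qlo Qhi hQ1 hQ2
  have e1 : -(B / P) * Qlo = -(Qlo * B / P) := by ring
  have e2 : -(B / P) * Qhi = -(Qhi * B / P) := by ring
  have e3 : -(B / P) * Q = -(Q * B / P) := by ring
  rw [e1, e2, e3] at hq
  refine le_trans ?_ hq
  exact min_le_min (s2 Qlo) (s2 Qhi)

/-- ★ `N1FromPieces` (PartN41-B §7): the finer (KT-1″) lower bound from brackets on `B`, `‖Π⁰‖²`, `A(x̂)`, `Q = ⟨Π⁰,C0⟩`, `B_C`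
at a ground profile with `0 < λ₂`, for `0 ≤ Δ`, `L ≥ 3` (the sign hypothesis `B⁺ ≤ 0` of the typed target is not needed). [folklore] -/
theorem n1_ge_pieces (hL : 3 ≤ L) {Δ lam2 : ℝ} (hΔ0 : 0 ≤ Δ) {f : Tor L → ℝ} (hf : IsGroundTwoMagnon L Δ lam2 f)
    (hl0 : 0 < lam2) {Blo Bhi Plo Phi Ahi Qlo Qhi Clo : ℝ}
    (hB1 : Blo ≤ Bterm L f) (hB2 : Bterm L f ≤ Bhi)
    (hPlo : 0 < Plo) (hP1 : Plo ≤ PiNormSq L f) (hP2 : PiNormSq L f ≤ Phi) (hA : Axhat L f ≤ Ahi)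
    (hQ1 : Qlo ≤ ∑ c : Cfg L, piR L f c * C0fn L Δ lam2 f c) (hQ2 : (∑ c : Cfg L, piR L f c * C0fn L Δ lam2 f c) ≤ Qhi)
    (hC : Clo ≤ BCterm L Δ lam2 f) :
    -(eps1 L) * Bhi
        + min (min (min (-(Qlo * Blo / Plo)) (-(Qlo * Blo / Phi))) (min (-(Qlo * Bhi / Plo)) (-(Qlo * Bhi / Phi))))
              (min (min (-(Qhi * Blo / Plo)) (-(Qhi * Blo / Phi))) (min (-(Qhi * Bhi / Plo)) (-(Qhi * Bhi / Phi))))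
        - eps1 L / 2 * (3 * lam2 * Phi + Qhi + 12 * Δ * f (K1 L) ^ 2 * Ahi) + Clo
      ≤ trialGapN1 L Δ f := by
  have hL2 : 2 ≤ L := by omega
  have heven : ∀ r : Tor L, f (-r) = f r := hf.2.1
  have hswap : ∀ r : Tor L, f (r.2, r.1) = f r := ground_swap L hL2 hf
  have hN1 := n1Identity_holds L Δ lam2 f hf.1
  have hG2 := g2OneLoopForm_holds L hL Δ lam2 f hf.1 heven hswap
  have hQ := sum_piR_C0fn L hf.1
  have hε : 0 ≤ eps1 L := by unfold eps1; linarith [Real.cos_le_one (2 * Real.pi / L)]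
  set T := Tplus L Δ f
  set B := Bterm L f
  set P := PiNormSq L f
  set A := Axhat L f
  set Q := ∑ c : Cfg L, piR L f c * C0fn L Δ lam2 f c with hQdef
  have hP : 0 < P := lt_of_lt_of_le hPlo hP1
  -- `T⁺ − 3λ₂ = Q/P` and `T⁺P = 3λ₂P + Q`
  have hTQ : T - 3 * lam2 = Q / P := by
    rw [hQ, mul_div_assoc, div_self hP.ne', mul_one]
  have hTP : T * P = 3 * lam2 * P + Q := by rw [hQ]; ring
  rw [hN1, hG2]
  -- the three pieces
  have h1 : -(eps1 L) * Bhi ≤ -(eps1 L) * B := by nlinarith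
  have h2 := neg_mul_div_ge_corners hQ1 hQ2 hB1 hB2 hPlo hP1 hP2
  have h3 : 3 * lam2 * P + Q + 12 * Δ * f (K1 L) ^ 2 * A ≤ 3 * lam2 * Phi + Qhi + 12 * Δ * f (K1 L) ^ 2 * Ahi := by
    have : 3 * lam2 * P ≤ 3 * lam2 * Phi := mul_le_mul_of_nonneg_left hP2 (by positivity)
    have : 12 * Δ * f (K1 L) ^ 2 * A ≤ 12 * Δ * f (K1 L) ^ 2 * Ahi := mul_le_mul_of_nonneg_left hA (by positivity)
    linarith
  have h3' := mul_le_mul_of_nonneg_left h3 (show 0 ≤ eps1 L / 2 by positivity)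
  -- rewrite the identity's right-hand side through `Q`
  have e : -(eps1 L + T - 3 * lam2) * B - eps1 L / 2 * (T * P + 12 * Δ * f (K1 L) ^ 2 * A) + BCterm L Δ lam2 f
      = -(eps1 L) * B + (-(Q * B / P)) - eps1 L / 2 * (3 * lam2 * P + Q + 12 * Δ * f (K1 L) ^ 2 * A) + BCterm L Δ lam2 f := by
    rw [hTP, show eps1 L + T - 3 * lam2 = eps1 L + (T - 3 * lam2) by ring, hTQ]
    ring
  rw [e]
  linarith

end KT1Assembly

end Summit.HubbardSuperconductivity.HubbardSuperconductivity.Theorems.AnisotropyChord.Transfer.Fibre3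

end
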